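import Summits.AtomisticToContinuum.FouriersLaw.Theses.EmbeddedDrudeMourre
import Literature.MathematicalPhysics.KineticTheory.LinearisedPhononCollisionOperator
import Literature.InformationTheory.Coding.SourcePolarizationStepMinus
import HarnessLib

/-!
# Stub K `stub_freeForceKernel`, the `(3,1)` non-resonance gap of the pinned band
(line `gram-pencil-harmonic-chaos`, crux `EmbeddedDrudeMourre.DrudeDissolution`,
item stmt-AtomisticToContinuum-12593; `--supports` file, closes nothing)

WHAT. In the chaos decomposition of the free force kernel of stub K, the four-phonon sector `(3,1)`
(three quanta created, one annihilated, zero total wavenumber) oscillates at the frequencies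
`ω(k₁) + ω(k₂) + ω(k₃) − ω(k₁ + k₂ + k₃)`. This file proves that these frequencies are bounded away
from `0` UNIFORMLY on the torus, for every pinning `ω₂ > 0`:

`8ω₂ / (√(9ω₂ + 36) + √(ω₂ + 36)) ≤ ω(k₁) + ω(k₂) + ω(k₃) − ω(k₁ + k₂ + k₃)`

(`dispersion_three_one_gap`, registered helper; `ω = PhononBoltzmann.dispersion ω₂`,
`ω(k) = √(ω₂ + 4 sin²(k/2))`), so that the `(3,1)/(1,3)` channels do not reach the threshold window.

HOW (planning docstring of stub K). Minkowski in `ℝ²`: `ω(k) = ‖(√ω₂, 2|sin(k/2)|)‖`, hence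
`Σᵢ ω(kᵢ) ≥ √(9ω₂ + 4S²)`, `S = Σᵢ |sin(kᵢ/2)| ≤ 3`; and `|sin((k₁+k₂+k₃)/2)| ≤ S`
(`|sin(x+y)| ≤ |sin x| + |sin y|`), hence `ω(k₁+k₂+k₃) ≤ √(ω₂ + 4S²)`; finally (Minkowski in the
tree's spelling `Literature.InformationTheory.Coding.Polar.sqrt_sq_add_sq_add_le`)
`√(9ω₂+4S²) − √(ω₂+4S²) = 8ω₂/(√(9ω₂+4S²) + √(ω₂+4S²)) ≥ 8ω₂/(√(9ω₂+36) + √(ω₂+36))`.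
-/

noncomputable section

open MeasureTheory Filter Set Function Topology
open scoped InnerProductSpace ENNReal
open Literature.MathematicalPhysics.KineticTheory
open Literature.MathematicalPhysics.KineticTheory.HeatConduction
open Literature.MathematicalPhysics.KineticTheory.PhononBoltzmann

namespace Summit.AtomisticToContinuum.FouriersLaw.Theorems.DrudeDissolution.GramPencilHarmonicChaos

/-- `|sin(x + y)| ≤ |sin x| + |sin y|`. [folklore] -/
theorem abs_sin_add_le (x y : ℝ) : |Real.sin (x + y)| ≤ |Real.sin x| + |Real.sin y| := by
  rw [Real.sin_add]
  refine (abs_add_le _ _).trans (add_le_add ?_ ?_)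
  · rw [abs_mul]
    exact mul_le_of_le_one_right (abs_nonneg _) (Real.abs_cos_le_one y)
  · rw [abs_mul]
    exact mul_le_of_le_one_left (abs_nonneg _) (Real.abs_cos_le_one x)

/-- The pinned band as a Euclidean norm: `ω(k) = √((√ω₂)² + (2|sin(k/2)|)²)` (`ω₂ ≥ 0`). [folklore] -/
theorem dispersion_eq_sqrt_norm {ω₂ : ℝ} (hω : 0 ≤ ω₂) (k : ℝ) :
    dispersion ω₂ k = Real.sqrt (Real.sqrt ω₂ ^ 2 + (2 * |Real.sin (k / 2)|) ^ 2) := by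
  rw [dispersion_eq_sqrt_sin_sq, Real.sq_sqrt hω, mul_pow, sq_abs]
  congr 1
  ring

/-- **Registered helper (stub K): the `(3,1)` channel of the pinned band is non-resonant, uniformly on
the torus.** For `ω₂ > 0` and all real `k₁, k₂, k₃`,
`8ω₂/(√(9ω₂+36) + √(ω₂+36)) ≤ ω(k₁) + ω(k₂) + ω(k₃) − ω(k₁+k₂+k₃)`. [folklore] -/
theorem dispersion_three_one_gap : ∀ ω₂ : ℝ, 0 < ω₂ → ∀ k₁ k₂ k₃ : ℝ, 8 * ω₂ / (Real.sqrt (9 * ω₂ + 36) + Real.sqrt (ω₂ + 36)) ≤ Literature.MathematicalPhysics.KineticTheory.PhononBoltzmann.dispersion ω₂ k₁ + Literature.MathematicalPhysics.KineticTheory.PhononBoltzmann.dispersion ω₂ k₂ + Literature.MathematicalPhysics.KineticTheory.PhononBoltzmann.dispersion ω₂ k₃ - Literature.MathematicalPhysics.KineticTheory.PhononBoltzmann.dispersion ω₂ (k₁ + k₂ + k₃) := by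
  intro ω₂ hω k₁ k₂ k₃
  -- the three half-angle sines and their sum `S ∈ [0, 3]`
  set s₁ : ℝ := |Real.sin (k₁ / 2)| with hs₁
  set s₂ : ℝ := |Real.sin (k₂ / 2)| with hs₂
  set s₃ : ℝ := |Real.sin (k₃ / 2)| with hs₃
  have hs₁0 : 0 ≤ s₁ := abs_nonneg _
  have hs₂0 : 0 ≤ s₂ := abs_nonneg _
  have hs₃0 : 0 ≤ s₃ := abs_nonneg _
  have hs₁1 : s₁ ≤ 1 := Real.abs_sin_le_one _
  have hs₂1 : s₂ ≤ 1 := Real.abs_sin_le_one _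
  have hs₃1 : s₃ ≤ 1 := Real.abs_sin_le_one _
  set S : ℝ := s₁ + s₂ + s₃ with hS
  have hS0 : 0 ≤ S := by positivity
  have hS3 : S ≤ 3 := by linarith
  set w : ℝ := Real.sqrt ω₂ with hw
  have hw2 : w ^ 2 = ω₂ := Real.sq_sqrt hω.le
  -- Minkowski: the sum of three band values
  have hlow : Real.sqrt (9 * ω₂ + 4 * S ^ 2) ≤
      dispersion ω₂ k₁ + dispersion ω₂ k₂ + dispersion ω₂ k₃ := by
    rw [dispersion_eq_sqrt_norm hω.le k₁, dispersion_eq_sqrt_norm hω.le k₂,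
      dispersion_eq_sqrt_norm hω.le k₃]
    have h12 := Literature.InformationTheory.Coding.Polar.sqrt_sq_add_sq_add_le w (2 * s₁) w (2 * s₂)
    have h123 :=
      Literature.InformationTheory.Coding.Polar.sqrt_sq_add_sq_add_le (w + w) (2 * s₁ + 2 * s₂) w (2 * s₃)
    have heq : Real.sqrt (9 * ω₂ + 4 * S ^ 2) =
        Real.sqrt ((w + w + w) ^ 2 + (2 * s₁ + 2 * s₂ + 2 * s₃) ^ 2) := by
      congr 1
      rw [hS, ← hw2]
      ring
    rw [heq]
    linarith
  -- the fourth band value: `|sin((k₁+k₂+k₃)/2)| ≤ S`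
  have hsin : |Real.sin ((k₁ + k₂ + k₃) / 2)| ≤ S := by
    have h3 : (k₁ + k₂ + k₃) / 2 = k₁ / 2 + k₂ / 2 + k₃ / 2 := by ring
    rw [h3]
    have h12 := abs_sin_add_le (k₁ / 2) (k₂ / 2)
    have h123 := abs_sin_add_le (k₁ / 2 + k₂ / 2) (k₃ / 2)
    linarith
  have hup : dispersion ω₂ (k₁ + k₂ + k₃) ≤ Real.sqrt (ω₂ + 4 * S ^ 2) := by
    rw [dispersion_eq_sqrt_sin_sq]
    apply Real.sqrt_le_sqrt
    have h2 : Real.sin ((k₁ + k₂ + k₃) / 2) ^ 2 ≤ S ^ 2 := by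
      rw [← sq_abs]
      exact pow_le_pow_left₀ (abs_nonneg _) hsin 2
    linarith
  -- `A − B = 8ω₂/(A + B)` and monotonicity in `S`
  set A : ℝ := Real.sqrt (9 * ω₂ + 4 * S ^ 2) with hA
  set B : ℝ := Real.sqrt (ω₂ + 4 * S ^ 2) with hB
  have hApos : 0 < A := Real.sqrt_pos.2 (by positivity)
  have hBpos : 0 < B := Real.sqrt_pos.2 (by positivity)
  have hA2 : A ^ 2 = 9 * ω₂ + 4 * S ^ 2 := Real.sq_sqrt (by positivity)
  have hB2 : B ^ 2 = ω₂ + 4 * S ^ 2 := Real.sq_sqrt (by positivity)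
  have hAB : A - B = 8 * ω₂ / (A + B) := by
    rw [eq_div_iff (by positivity)]
    have h : (A - B) * (A + B) = A ^ 2 - B ^ 2 := by ring
    rw [h, hA2, hB2]
    ring
  have hAle : A ≤ Real.sqrt (9 * ω₂ + 36) := Real.sqrt_le_sqrt (by nlinarith)
  have hBle : B ≤ Real.sqrt (ω₂ + 36) := Real.sqrt_le_sqrt (by nlinarith)
  calc 8 * ω₂ / (Real.sqrt (9 * ω₂ + 36) + Real.sqrt (ω₂ + 36))
      ≤ 8 * ω₂ / (A + B) :=
        div_le_div_of_nonneg_left (by positivity) (by positivity) (add_le_add hAle hBle)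
    _ = A - B := hAB.symm
    _ ≤ _ := by linarith

/-- The `(3,1)` gap constant is positive. [folklore] -/
theorem three_one_gap_const_pos {ω₂ : ℝ} (hω : 0 < ω₂) :
    0 < 8 * ω₂ / (Real.sqrt (9 * ω₂ + 36) + Real.sqrt (ω₂ + 36)) := by
  positivity

/-- The zero-wavenumber form of the `(3,1)` gap: if the annihilated momentum is `k₄ ≡ k₁ + k₂ + k₃`
modulo `2π`, the sector frequency `ω₁ + ω₂ + ω₃ − ω₄` is at least the gap constant (periodicity of
the band). [folklore] -/
theorem dispersion_three_one_gap_mod {ω₂ : ℝ} (hω : 0 < ω₂) (k₁ k₂ k₃ : ℝ) (n : ℤ) :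
    8 * ω₂ / (Real.sqrt (9 * ω₂ + 36) + Real.sqrt (ω₂ + 36)) ≤
      dispersion ω₂ k₁ + dispersion ω₂ k₂ + dispersion ω₂ k₃ -
        dispersion ω₂ (k₁ + k₂ + k₃ + n * (2 * Real.pi)) := by
  rw [(dispersion_periodic ω₂).int_mul n (k₁ + k₂ + k₃)]
  exact dispersion_three_one_gap ω₂ hω k₁ k₂ k₃

/-- The same gap for the two-phonon sectors `(2,0)/(0,2)` and `(4,0)/(0,4)`, which sit above
`2√ω₂` (a fortiori `4√ω₂`): every band value is at least `√ω₂ > 0`. [folklore] -/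
theorem dispersion_add_dispersion_ge {ω₂ : ℝ} (k₁ k₂ : ℝ) :
    2 * Real.sqrt ω₂ ≤ dispersion ω₂ k₁ + dispersion ω₂ k₂ := by
  have h1 := sqrt_le_dispersion (ω₂ := ω₂) k₁
  have h2 := sqrt_le_dispersion (ω₂ := ω₂) k₂
  linarith

end Summit.AtomisticToContinuum.FouriersLaw.Theorems.DrudeDissolution.GramPencilHarmonicChaos

end
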